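import Literature.Barriers.NavierStokesRegularity.NavierStokesInequalitySwitching
import Literature.MeasureTheory.Hausdorff.SelfSimilarCode
import HarnessLib

/-!
# Scheffer's Cantor-set switching: the two ingredients of `NavierStokesInequalityNearlyOneDimSingularSet`

Barrier catalogue support file for `NavierStokesRegularity` (D-0021). It decomposes the named
fact `Literature.Barriers.NavierStokesRegularity.NavierStokesInequalityNearlyOneDimSingularSet`
(Scheffer 1987 = Ożański 2020, Thm. 1.6: for every `ξ ∈ (0,1)` a weak solution of the
Navier–Stokes inequality (NSI) whose singular set has Hausdorff dimension `≥ ξ`) along the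
architecture of its printed proof, in the simplified presentation of W. S. Ożański,
arXiv:1709.00602 (`Ozanski2017NSISingular`), §6 "Weak solution to the Navier–Stokes inequality
with a blow-up on a Cantor set" (Thm. 14, Prop. 15, Prop. 16 and the sketch §6.2); the original
is V. Scheffer, Comm. Math. Phys. 110 (1987), §5 "The Cantor set" (Lemmas 5.5–5.15). It is the
`M`-adic twin of the accepted `NavierStokesInequalitySwitching` (the one-point blow-up,
Ożański's Thm. 1 = Scheffer 1985), whose vocabulary (`switchTime`, `blowupTime`,
`IsWeakNSISolution`, `positiveTimes`) it reuses, and it imports the PROVED dimension bound for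
self-similar Cantor dusts (`Literature.MeasureTheory.Hausdorff.CantorDust.le_dimH_range_code`,
Moran 1946 = Ożański's Prop. 15 = Scheffer's Lemma 5.14).

## What is printed (Ożański 2017, §6.1–§6.2, pp. 27–30)

Fix `ξ ∈ (0,1)`. The *geometric arrangement* (§6.2, constructed in §6.5) provides structures
`(v₁,f₁,φ₁)`, `(v₂,f₂,φ₂)` on `U₁, U₂ ⋐ P`, numbers `T > 0`, `X > 0`, `τ ∈ (0,1)`, `M ∈ ℕ`, a
point `z = (z₁,z₂,0)`, with `τ^ξ M ≥ 1`, `τM < 1` ((6.2)), such that the similarities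
`Γ_n(x) = τx + z + (n-1)(X,0,0)`, `n = 1,…,M`, map `G = R(Ū₁ ∪ Ū₂)` onto PAIRWISE DISJOINT
subsets of `G₂ ⊆ G` ((6.3)), and (6.6)–(6.7) hold; `ν₀ > 0` is the number (4.13). With the
composites `Γ_m = Γ_{m_1} ∘ ⋯ ∘ Γ_{m_j}`, `m ∈ M(j) = {1,…,M}^j`, the Cantor set is
`S = ⋂_{j≥0} ⋃_{m∈M(j)} Γ_m(G)` ((6.4)) and `ξ ≤ d_H(S) ≤ 1` ((6.5), by Prop. 15 = Falconer
Ex. 4.5 and a Lipschitz projection). Prop. 16 gives, for every `j ≥ 0`, a classical solution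
`v^{(j)} ∈ C^∞(ℝ³ × [0,T]; ℝ³)` of the NSI for all `ν ∈ [0,ν₀]` made of `M^j` disjoint translates,
and (6.13) rescales it to `u^{(j)}(x,t) = τ^{-j} v^{(j)}(τ^{-j}x₁, γ^{-j}(x₂), τ^{-j}x₃, τ^{-2j}(t - t_j))`
on `[t_j, t_{j+1}]`, `t_j = T Σ_{k<j} τ^{2k}`; the text then derives: `u^{(j)}` is `C^∞` on
`ℝ³ × [t_j,t_{j+1}]` (:= on an open slab around it), divergence free, satisfies the pointwise NSI
`∂ₜ|u^{(j)}|² ≤ -u^{(j)}·∇(|u^{(j)}|² + 2p^{(j)}) + 2ν u^{(j)}·Δu^{(j)}` for all `ν ∈ [0,ν₀]`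
((6.15), `p^{(j)}` the pressure function of `u^{(j)}`), `supp u^{(j)}(t) = ⋃_{m∈M(j)} Γ_m(G)`
((6.14)), the magnitude drop `|u^{(j)}(x,t_j)| ≤ |u^{(j-1)}(x,t_j)|` ((6.16)), the uniform
growth `|u^{(j)}(Γ_m(y), t_j)| = τ^{-j} h₀(R⁻¹y)` for `y ∈ G` ((6.17)), and the bounds
`sup_t ‖u^{(j)}(t)‖ < ∞`, `Σ_j ∫‖∇u^{(j)}‖² < ∞` (p. 30, from Prop. 16 (iv) "with `τ` replaced by
`Mτ`" in (2.8)–(2.9)). Finally ((6.18)) `𝔲(t) = u^{(j)}(t)` on `[t_j,t_{j+1})`, `𝔲(t) = 0` for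
`t ≥ T₀ = T/(1-τ²)`, "is a weak solution to the NSI … as in the case of Theorem 1", with `C^∞`
slices supported in `G`, and it is unbounded in every neighbourhood of every point of
`S × {T₀}` (p. 30: take `y ∈ G` with `h₀(R⁻¹y) > 0` and `Γ_m(G) × [t_j,T₀] ⊂ V`,
`τ^{-j} ≥ 𝒩/h₀(R⁻¹y)`), so `d_H` of the singular set is `≥ ξ`. Scheffer 1987: Lemma 5.5 (the
fields `v^Z, q^Z`), Lemmas 5.6–5.8 (gain, drop, supports), (5.39) (the glued `u, p`), Lemmas
5.9–5.13 (energy, integrability, the local energy inequality (1.7)), Lemma 5.14 (`dim S > ζ`,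
by Moran's theorem), Lemma 5.15 (not essentially bounded near `S'`), and "the proof is
completed with a change of scale" (p. 551).

## Rendering (this file)

* `IsNSICantorBlock T ν₀ τ M d G w` — the hypotheses under which §6.2 runs its switching
  argument, stated for the RESCALED pieces `w j = u^{(j)}` (time first, `w j : ℝ → ℝ³ → ℝ³`)
  on `[t_j, t_{j+1}] × ℝ³`, `t_j = switchTime T τ j`: joint smoothness on an open slab around
  `[t_j,t_{j+1}]` (`IsSmoothSpaceTimeOn`), `div = 0` (`IsDivFree`), supports in the `j`-th
  generation `⋃_{m∈M(j)} Γ_m(G)` (`CantorDust.level τ d G j`, words `m : Fin j → Fin M`,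
  `Γ_n(x) = τx + d n` for a general family of translations `d : Fin M → ℝ³`), the pointwise NSI
  (6.15) for every `ν ∈ [0,ν₀]` with the pressure function `p̃[w j t] = -Δ⁻¹∂ᵢ∂ⱼ(uᵢuⱼ)`
  (`Literature.Analysis.FluidPDE.normalisedPressure`, as in `IsNSIBlock`), the drop (6.16),
  the growth (6.17) in the weakened form "`≥ c τ^{-j}` at the point `Γ_m(y)` of every component,
  for one `y ∈ G`, `c > 0`", the two bounds of p. 30, and (6.3): `Γ_n(G) ⊆ G` pairwise disjoint.
  Taking the rescaled pieces as the data (rather than Prop. 16's `v^{(j)}` and formula (6.13))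
  keeps the block free of the axisymmetric apparatus `R, P, h_t, γ`; the translation family `d`
  is general (printed: `d n = z + nX x̂₁`, `x̂₁` the unit vector of the symmetry axis).
* `NSICantorSwitching` (fact A′) — the conclusion of §6.2 for such a block: a field `𝔲` equal to
  `w j` on `[t_j,t_{j+1})` and to `0` from `T₀ = blowupTime T τ` on, which is a weak NSI solution
  (`IsWeakNSISolution`, pressure `t ↦ p̃[𝔲(t)]`) for every `ν ∈ [0,ν₀]`, has `C^∞` slices
  supported in `G` for `t ≥ 0`.
* `NSICantorBlockExists` (fact B′) — for every `ξ ∈ (0,1)`: a block with the printed similarity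
  data, written in the TREE's axisymmetric coordinates (axis `x 2`, `x̂₁ = eZ =
  EuclideanSpace.single 2 1`, meridian plane `{x 1 = 0}`; the convention of the accepted
  `NavierStokesInequalityArrangement`, where Ożański's axial `x₁` is our `x 2` and his `x₃` is our
  `x 1`): `d n = z + nX • EuclideanSpace.single 2 1` (`n = 0,…,M-1`; printed
  `Γ_n(x) = τx + z + (n-1)(X,0,0)`), `z 1 = 0` (printed `z = (z₁,z₂,0)`), `X > 0`, `τ^ξ M ≥ 1`,
  `τM < 1` (§6.5 geometric arrangement + Prop. 16 + (6.13)–(6.17)). The heart of Scheffer's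
  construction; nothing asserted.
* PROVED: `IsNSICantorBlock.not_isRegularPoint` — every point `(T₀, x)`, `x ∈ S =
  CantorDust.limitSet τ d G`, is singular (in the essential sense `¬ IsRegularPoint` of the
  barrier file) for ANY field agreeing with the pieces on `[t_j,t_{j+1})` (Ożański p. 30;
  Scheffer's Lemma 5.15); `IsNSICantorBlock.ofReal_le_dimH_limitSet` (`ξ ≤ dim_H S` from
  Moran's bound and `range code ⊆ S`, Scheffer's Lemma 5.14); and the assembly
  `navierStokesInequalityNearlyOneDimSingularSet_of_cantorSwitching : A′ → B′ → fact`
  (`K = G`, `p = p̃[𝔲(·)]`, viscosity `ν₀`; `{T₀} × S` embeds isometrically into the singular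
  set, so `dim_H ≥ dim_H S ≥ ξ`).

## References

* W. S. Ożański, arXiv:1709.00602 (2017), §6: Thm. 14, Prop. 15, (6.2)–(6.7), Prop. 16,
  (6.13)–(6.18), §6.3–§6.5. [`Ozanski2017NSISingular`]
* V. Scheffer, Comm. Math. Phys. 110 (1987), 525–551: Theorem (§1), §5 Lemmas 5.5–5.15, (5.39).
  [`Scheffer1987`]
* W. S. Ożański, Comm. Math. Phys. 374 (2020), Thm. 1.6. [`Ozanski2019NSI`]
* P. A. P. Moran, Proc. Cambridge Philos. Soc. 42 (1946), Thm. II. [`Moran1946`]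
-/

noncomputable section

open MeasureTheory Set Function Filter Topology TopologicalSpace Laplacian
open Literature.MeasureTheory.Hausdorff
open scoped ENNReal NNReal InnerProductSpace RealInnerProductSpace ContDiff

namespace Literature.Barriers.NavierStokesRegularity

/-- Local notation for physical space `ℝ³ = EuclideanSpace ℝ (Fin 3)`. -/
local notation "ℝ³" => EuclideanSpace ℝ (Fin 3)

/-! ### The Cantor block (Ożański 2017, §6.2; Scheffer 1987, §5) -/

/-- **A Cantor family of classical Navier–Stokes-inequality pieces** (the hypotheses of the
switching argument of Ożański 2017, §6.2, for the rescaled fields `u^{(j)}` of (6.13); Scheffer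
1987, Lemma 5.5 with (5.34)–(5.38)): numbers `T > 0`, `ν₀ > 0`, `τ ∈ (0,1)`, `M` similarities
`Γ_n(x) = τx + d n` of `ℝ³`, a compact `G` with `Γ_n(G) ⊆ G` pairwise disjoint ((6.3)), and
pieces `w j = u^{(j)} : ℝ × ℝ³ → ℝ³` (time first), `j ≥ 0`, such that, with
`t_j = switchTime T τ j`:
* `w j` is `C^∞` on an open slab around `[t_j, t_{j+1}] × ℝ³`
  ("`u^{(j)} ∈ C^∞(ℝ³ × [t_j,t_{j+1}]; ℝ³)`");
* for `t ∈ [t_j,t_{j+1}]`: `div w j(t) = 0` and `supp w j(t) ⊆ ⋃_{m∈M(j)} Γ_m(G)` ((6.14));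
* the pointwise NSI (6.15) on `[t_j,t_{j+1}] × ℝ³` for EVERY `ν ∈ [0,ν₀]`, with the pressure
  function `p̃[w j(t)] = -Δ⁻¹∂ᵢ∂ⱼ(uᵢuⱼ)` of the slice;
* the magnitude drop (6.16) at every switching time: `|w (j+1)(t_{j+1})| ≤ |w j(t_{j+1})|`;
* `sup_{j,t} ‖w j(t)‖_{L²} < ∞` and `Σ_j ∫_{t_j}^{t_{j+1}} ‖∇ w j‖²_{L²} < ∞` (p. 30);
* uniform growth on every component ((6.17), weakened to an inequality): for some `y ∈ G`,
  `c > 0`: `|w j(Γ_m(y), t_j)| ≥ c τ^{-j}` for all `j` and `m ∈ M(j)`.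
[cite: Ozanski2017NSISingular, §6.2 (6.3), (6.13)–(6.17) and p. 30] [cite: Scheffer1987, Lemmas 5.5–5.8] -/
structure IsNSICantorBlock (T ν₀ τ : ℝ) (M : ℕ) (d : Fin M → ℝ³) (G : Set ℝ³)
    (w : ℕ → ℝ → ℝ³ → ℝ³) : Prop where
  /-- The lifetime of the first piece is positive. -/
  T_pos : 0 < T
  /-- The maximal viscosity is positive. -/
  ν₀_pos : 0 < ν₀
  /-- The similarity ratio is positive … -/
  τ_pos : 0 < τ
  /-- … and less than one. -/
  τ_lt_one : τ < 1
  /-- The common container `G` is compact. -/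
  isCompact : IsCompact G
  /-- (6.3): each `Γ_n(x) = τx + d n` maps `G` into itself … -/
  mapsTo : ∀ n : Fin M, MapsTo (fun x : ℝ³ => τ • x + d n) G G
  /-- … and the images `Γ_n(G)` are pairwise disjoint. -/
  disjoint : Pairwise fun n n' : Fin M =>
    Disjoint ((fun x : ℝ³ => τ • x + d n) '' G) ((fun x : ℝ³ => τ • x + d n') '' G)
  /-- `w j ∈ C^∞(ℝ³ × [t_j, t_{j+1}])`: jointly smooth on an open slab around it. -/
  smooth : ∀ j : ℕ, ∃ η : ℝ, 0 < η ∧ Literature.Analysis.FluidPDE.IsSmoothSpaceTimeOn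
    (Ioo (switchTime T τ j - η) (switchTime T τ (j + 1) + η)) (w j)
  /-- `div w j(t) = 0` for `t ∈ [t_j, t_{j+1}]`. -/
  divFree : ∀ j : ℕ, ∀ t ∈ Icc (switchTime T τ j) (switchTime T τ (j + 1)),
    Literature.Analysis.FluidPDE.VectorCalculus.IsDivFree (w j t)
  /-- (6.14): `supp w j(t) ⊆ ⋃_{m ∈ M(j)} Γ_m(G)` for `t ∈ [t_j, t_{j+1}]`. -/
  tsupport_subset : ∀ j : ℕ, ∀ t ∈ Icc (switchTime T τ j) (switchTime T τ (j + 1)),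
    tsupport (w j t) ⊆ CantorDust.level τ d G j
  /-- (6.15): the pointwise Navier–Stokes inequality on `[t_j,t_{j+1}] × ℝ³` for every
  `ν ∈ [0, ν₀]`: `∂ₜ|u|² ≤ -u·∇(|u|² + 2p̃[u(t)]) + 2ν u·Δu`, `u = w j`. -/
  nsi : ∀ j : ℕ, ∀ ν ∈ Icc (0 : ℝ) ν₀, ∀ t ∈ Icc (switchTime T τ j) (switchTime T τ (j + 1)),
    ∀ x : ℝ³, Literature.Analysis.FluidPDE.timeDeriv (fun s y => ‖w j s y‖ ^ 2) t x ≤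
      -⟪w j t x, gradient (fun y => ‖w j t y‖ ^ 2 +
          2 * Literature.Analysis.FluidPDE.normalisedPressure (w j t) y) x⟫ +
        2 * ν * ⟪w j t x, Δ (w j t) x⟫
  /-- (6.16): the magnitude drops at every switching time, `|w (j+1)(x, t_{j+1})| ≤ |w j(x, t_{j+1})|`. -/
  drop : ∀ (j : ℕ) (x : ℝ³),
    ‖w (j + 1) (switchTime T τ (j + 1)) x‖ ≤ ‖w j (switchTime T τ (j + 1)) x‖
  /-- `sup_{j} sup_{t ∈ [t_j,t_{j+1}]} ‖w j(t)‖²_{L²} < ∞` (p. 30). -/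
  energy : ∃ C : ℝ≥0, ∀ j : ℕ, ∀ t ∈ Icc (switchTime T τ j) (switchTime T τ (j + 1)),
    ∫⁻ x, ‖w j t x‖ₑ ^ 2 ≤ C
  /-- `Σ_j ∫_{t_j}^{t_{j+1}} ∫ |∇ w j|² < ∞` (p. 30). -/
  dissipation : (∑' j : ℕ, ∫⁻ t in Icc (switchTime T τ j) (switchTime T τ (j + 1)),
    ∫⁻ x, ENNReal.ofReal (Literature.Analysis.FluidPDE.frobeniusNormSq (fderiv ℝ (w j t) x))) < ⊤
  /-- (6.17), weakened: uniform growth `|w j(Γ_m(y), t_j)| ≥ c τ^{-j}` on every component. -/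
  growth : ∃ y ∈ G, ∃ c : ℝ, 0 < c ∧ ∀ (j : ℕ) (m : Fin j → Fin M),
    c * τ⁻¹ ^ j ≤ ‖w j (switchTime T τ j) (CantorDust.word τ d m y)‖

namespace IsNSICantorBlock

variable {T ν₀ τ : ℝ} {M : ℕ} {d : Fin M → ℝ³} {G : Set ℝ³} {w : ℕ → ℝ → ℝ³ → ℝ³}

/-- The blow-up time `T₀ = T/(1-τ²)` is positive. [cite: Ozanski2017NSISingular, §6.2 (6.18)] -/
theorem blowupTime_pos (h : IsNSICantorBlock T ν₀ τ M d G w) : 0 < blowupTime T τ := by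
  simpa using switchTime_lt_blowupTime h.T_pos h.τ_pos h.τ_lt_one 0

/-- The container `G` is nonempty (it contains the growth point `y`). [folklore] -/
theorem nonempty (h : IsNSICantorBlock T ν₀ τ M d G w) : G.Nonempty := by
  obtain ⟨y, hy, -⟩ := h.growth
  exact ⟨y, hy⟩

/-- The coded points `Σ_k τ^k d(ω_k)` of the similarity family lie in the Cantor set
`S = ⋂_j ⋃_{m∈M(j)} Γ_m(G)` (`G` is compact, nonempty and `Γ_n`-invariant). [folklore] -/
theorem range_code_subset_limitSet (h : IsNSICantorBlock T ν₀ τ M d G w) :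
    range (CantorDust.code τ d) ⊆ CantorDust.limitSet τ d G :=
  CantorDust.range_code_subset_limitSet h.τ_pos.le h.τ_lt_one h.isCompact.isClosed h.nonempty
    h.mapsTo

/-- **`dim_H S ≥ ξ` (Ożański 2017, (6.5); Scheffer 1987, Lemma 5.14).** For collinear equally
spaced similarity data `d n = z + nX eᵢ` along a coordinate axis `eᵢ = EuclideanSpace.single i 1`
(printed: the symmetry axis, `i = 2` in the tree's convention), `X > 0`, with `τM < 1` and
`τ^ξ M ≥ 1`, the Cantor set `S = ⋂_j ⋃_m Γ_m(G)` of a block has Hausdorff dimension at least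
`ξ`: it contains the coded Cantor dust, to which Moran's bound `CantorDust.le_dimH_range_code`
applies with `δ = X`, `D = (M-1)X` (`τ(M-1)X < X(1-τ)` iff `τM < 1`). PROVED.
[cite: Ozanski2017NSISingular, §6.1 (6.5) and Prop. 15] [cite: Scheffer1987, Lemma 5.14] -/
theorem ofReal_le_dimH_limitSet {X : ℝ} {z : ℝ³} {i : Fin 3}
    (h : IsNSICantorBlock T ν₀ τ M (fun n => z + (((n : ℕ) : ℝ) * X) • EuclideanSpace.single i 1) G w)
    (hX : 0 < X) (hτM : τ * M < 1) {ξ : ℝ} (hξ : 0 ≤ ξ) (hξM : 1 ≤ τ ^ ξ * M) :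
    ENNReal.ofReal ξ ≤ dimH (CantorDust.limitSet τ
      (fun n : Fin M => z + (((n : ℕ) : ℝ) * X) • EuclideanSpace.single i 1) G) := by
  set d : Fin M → ℝ³ := fun n => z + (((n : ℕ) : ℝ) * X) • EuclideanSpace.single i 1 with hd
  have hnorm : ∀ n n' : Fin M, ‖d n - d n'‖ = |((n : ℕ) : ℝ) - ((n' : ℕ) : ℝ)| * X :=
    fun n n' => by
      simp only [hd, add_sub_add_left_eq_sub, ← sub_smul, ← sub_mul, norm_smul,
        PiLp.norm_single, norm_one, mul_one, Real.norm_eq_abs, abs_mul, abs_of_pos hX]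
  have hle : ∀ n : Fin M, ((n : ℕ) : ℝ) ≤ (M : ℝ) - 1 := fun n => by
    have : ((n : ℕ) : ℝ) + 1 ≤ M := by exact_mod_cast n.is_lt
    linarith
  have hD : ∀ n n' : Fin M, ‖d n - d n'‖ ≤ ((M : ℝ) - 1) * X := fun n n' => by
    rw [hnorm]
    refine mul_le_mul_of_nonneg_right (abs_sub_le_iff.2 ⟨?_, ?_⟩) hX.le
    · linarith [hle n, Nat.cast_nonneg (α := ℝ) (n' : ℕ)]
    · linarith [hle n', Nat.cast_nonneg (α := ℝ) (n : ℕ)]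
  have hδ : ∀ n n' : Fin M, n ≠ n' → X ≤ ‖d n - d n'‖ := fun n n' hne => by
    rw [hnorm]
    have hne' : (n : ℕ) ≠ n' := fun h => hne (Fin.ext h)
    have h1 : (1 : ℝ) ≤ |((n : ℕ) : ℝ) - ((n' : ℕ) : ℝ)| := by
      rcases Nat.lt_or_gt_of_ne hne' with hlt | hlt
      · have : ((n : ℕ) : ℝ) + 1 ≤ ((n' : ℕ) : ℝ) := by exact_mod_cast hlt
        rw [abs_sub_comm, abs_of_nonneg (by linarith)]
        linarith
      · have : ((n' : ℕ) : ℝ) + 1 ≤ ((n : ℕ) : ℝ) := by exact_mod_cast hlt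
        rw [abs_of_nonneg (by linarith)]
        linarith
    calc X = 1 * X := (one_mul X).symm
      _ ≤ _ := mul_le_mul_of_nonneg_right h1 hX.le
  have hsep : τ * (((M : ℝ) - 1) * X) < X * (1 - τ) := by
    have h1 : τ * (((M : ℝ) - 1) * X) = (τ * M - τ) * X := by ring
    have h2 : X * (1 - τ) = (1 - τ) * X := by ring
    rw [h1, h2]
    exact mul_lt_mul_of_pos_right (by linarith) hX
  exact (CantorDust.le_dimH_range_code h.τ_pos h.τ_lt_one hD hδ hsep hξ hξM).trans
    (dimH_mono h.range_code_subset_limitSet)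

/-- Two points of one generation-`j` component `Γ_m(G)` are within `τ^j diam G` of each other
(`Γ_m` is a similarity of ratio `τ^j`). [folklore] -/
theorem dist_word_le (h : IsNSICantorBlock T ν₀ τ M d G w) {j : ℕ} (m : Fin j → Fin M)
    {a b : ℝ³} (ha : a ∈ G) (hb : b ∈ G) :
    dist (CantorDust.word τ d m a) (CantorDust.word τ d m b) ≤ τ ^ j * Metric.diam G := by
  rw [CantorDust.word, CantorDust.word, dist_eq_norm, add_sub_add_right_eq_sub, ← smul_sub,
    norm_smul, norm_pow, Real.norm_of_nonneg h.τ_pos.le, ← dist_eq_norm]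
  exact mul_le_mul_of_nonneg_left (Metric.dist_le_diam_of_mem h.isCompact.isBounded ha hb)
    (pow_nonneg h.τ_pos.le _)

/-- **The Cantor set is singular (Ożański 2017, p. 30; Scheffer 1987, Lemma 5.15), PROVED.**
If a field `𝔲` agrees with the piece `w j` on `[t_j, t_{j+1}) × ℝ³` for every `j`, then no point
`(T₀, x)` with `x ∈ S = ⋂_j ⋃_{m∈M(j)} Γ_m(G)` is a regular point of `𝔲` (essential
boundedness on a centred parabolic cylinder `Q*_r(T₀, x)` fails): for large `j` the component
`Γ_m(G) ∋ x` of generation `j` has diameter `τ^j diam G < r/2` and `t_j ∈ (T₀ - r², T₀)`, the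
piece `w j` is continuous near `(t_j, Γ_m(y))` where `|w j| ≥ c τ^{-j}` exceeds any essential
bound, so `|𝔲|` exceeds it on a set of positive measure inside the cylinder ("the magnitude of
`𝔲` grows uniformly on each component of its support", p. 30; Scheffer: "`|u| ≥ N` holds on a
set `W ⊂ V` of positive Lebesgue measure", p. 551).
[cite: Ozanski2017NSISingular, §6.2 p. 30] [cite: Scheffer1987, Lemma 5.15] -/
theorem not_isRegularPoint (h : IsNSICantorBlock T ν₀ τ M d G w) {𝔲 : ℝ → ℝ³ → ℝ³}
    (h𝔲 : ∀ j : ℕ, ∀ t ∈ Ico (switchTime T τ j) (switchTime T τ (j + 1)), 𝔲 t = w j t)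
    {x : ℝ³} (hx : x ∈ CantorDust.limitSet τ d G) :
    ¬ Literature.Analysis.FluidPDE.IsRegularPoint 𝔲 (blowupTime T τ, x) := by
  rintro ⟨r, hr, hfin⟩
  set Q : Set (ℝ × ℝ³) :=
    Literature.Analysis.FluidPDE.parabolicCylinderCentered r (blowupTime T τ, x) with hQ
  have hQm : MeasurableSet Q :=
    (Literature.Analysis.FluidPDE.isOpen_parabolicCylinderCentered r _).measurableSet
  set B : ℝ≥0∞ := eLpNorm (uncurry 𝔲) ∞ (volume.restrict Q) with hB
  have hBtop : B ≠ ⊤ := hfin.ne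
  have hae : ∀ᵐ z ∂(volume.restrict Q), ‖uncurry 𝔲 z‖ₑ ≤ B := by
    rw [hB, eLpNorm_exponent_top]
    exact enorm_ae_le_eLpNormEssSup _ _
  have hnull : volume ({z : ℝ × ℝ³ | ¬ ‖uncurry 𝔲 z‖ₑ ≤ B} ∩ Q) = 0 := by
    rw [← Measure.restrict_apply' hQm]
    exact ae_iff.1 hae
  -- the growth point and the choice of the generation `j`
  obtain ⟨y, hyG, c, hc, hgrowth⟩ := h.growth
  have hτinv : 1 < τ⁻¹ := (one_lt_inv₀ h.τ_pos).2 h.τ_lt_one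
  have hT₀ : 0 < blowupTime T τ := h.blowupTime_pos
  have ev1 : ∀ᶠ j : ℕ in atTop, blowupTime T τ - r ^ 2 < switchTime T τ j :=
    (tendsto_switchTime h.τ_pos.le h.τ_lt_one).eventually
      (Ioi_mem_nhds (by nlinarith : blowupTime T τ - r ^ 2 < blowupTime T τ))
  have ev2 : ∀ᶠ j : ℕ in atTop, τ ^ j * Metric.diam G < r / 2 := by
    have ht : Tendsto (fun j : ℕ => τ ^ j * Metric.diam G) atTop (𝓝 (0 * Metric.diam G)) :=
      (tendsto_pow_atTop_nhds_zero_of_lt_one h.τ_pos.le h.τ_lt_one).mul_const _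
    rw [zero_mul] at ht
    exact ht.eventually (gt_mem_nhds (by positivity))
  have ev3 : ∀ᶠ j : ℕ in atTop, B.toReal + 1 < c * τ⁻¹ ^ j :=
    ((tendsto_pow_atTop_atTop_of_one_lt hτinv).const_mul_atTop hc).eventually_gt_atTop _
  obtain ⟨j, hj1, hj2, hj3⟩ := (ev1.and (ev2.and ev3)).exists
  -- the component of generation `j` containing `x`, and the growth point `y₀` in it
  obtain ⟨m, x', hx'G, hx'eq⟩ := mem_iUnion.1 (mem_iInter.1 hx j)
  set y₀ : ℝ³ := CantorDust.word τ d m y with hy₀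
  have hdist : dist y₀ x < r / 2 := by
    rw [← hx'eq]
    exact (h.dist_word_le m hyG hx'G).trans_lt hj2
  have hbig : B.toReal + 1 < ‖w j (switchTime T τ j) y₀‖ := hj3.trans_le (hgrowth j m)
  -- continuity of the piece at `(t_j, y₀)`
  obtain ⟨η, hη, hsm⟩ := h.smooth j
  have htj : switchTime T τ j < switchTime T τ (j + 1) :=
    strictMono_switchTime h.T_pos h.τ_pos (Nat.lt_succ_self j)
  have htj' : switchTime T τ (j + 1) < blowupTime T τ :=
    switchTime_lt_blowupTime h.T_pos h.τ_pos h.τ_lt_one (j + 1)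
  have hmem : (switchTime T τ j, y₀) ∈
      Ioo (switchTime T τ j - η) (switchTime T τ (j + 1) + η) ×ˢ (univ : Set ℝ³) :=
    ⟨⟨by linarith, by linarith⟩, mem_univ _⟩
  have hcont : ContinuousAt (uncurry (w j)) (switchTime T τ j, y₀) :=
    (hsm.continuousOn.continuousWithinAt hmem).continuousAt
      ((isOpen_Ioo.prod isOpen_univ).mem_nhds hmem)
  have hO : {z : ℝ × ℝ³ | B.toReal + 1 / 2 < ‖uncurry (w j) z‖} ∈ 𝓝 (switchTime T τ j, y₀) := by
    refine hcont.norm.preimage_mem_nhds (Ioi_mem_nhds ?_)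
    simp only [uncurry_apply_pair]
    linarith
  obtain ⟨ε, hε, hball⟩ := Metric.mem_nhds_iff.1 hO
  -- a product set of positive measure inside the cylinder on which `|𝔲| > B`
  set ε₁ : ℝ := min ε (min (switchTime T τ (j + 1) - switchTime T τ j) (r / 2)) with hε₁
  have hε₁pos : 0 < ε₁ := lt_min hε (lt_min (by linarith) (by linarith))
  have hε₁ε : ε₁ ≤ ε := min_le_left _ _
  have hε₁t : ε₁ ≤ switchTime T τ (j + 1) - switchTime T τ j :=
    (min_le_right _ _).trans (min_le_left _ _)
  have hε₁r : ε₁ ≤ r / 2 := (min_le_right _ _).trans (min_le_right _ _)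
  set A : Set (ℝ × ℝ³) := Ico (switchTime T τ j) (switchTime T τ j + ε₁) ×ˢ Metric.ball y₀ ε₁
    with hA
  have hAQ : A ⊆ Q := by
    rintro ⟨t, y'⟩ ⟨⟨ht1, ht2⟩, hy'⟩
    refine Literature.Analysis.FluidPDE.mem_parabolicCylinderCentered.2 ⟨⟨?_, ?_⟩, ?_⟩
    · exact hj1.trans_le ht1
    · dsimp only
      nlinarith
    · calc dist y' x ≤ dist y' y₀ + dist y₀ x := dist_triangle _ _ _
        _ < ε₁ + r / 2 := add_lt_add (Metric.mem_ball.1 hy') hdist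
        _ ≤ r := by linarith
  have hAbig : A ⊆ {z : ℝ × ℝ³ | ¬ ‖uncurry 𝔲 z‖ₑ ≤ B} := by
    rintro ⟨t, y'⟩ ⟨⟨ht1, ht2⟩, hy'⟩
    have hzO : (t, y') ∈ {z : ℝ × ℝ³ | B.toReal + 1 / 2 < ‖uncurry (w j) z‖} := by
      refine hball (Metric.mem_ball.2 ?_)
      rw [Prod.dist_eq, max_lt_iff]
      refine ⟨?_, (Metric.mem_ball.1 hy').trans_le hε₁ε⟩
      rw [Real.dist_eq, abs_of_nonneg (by linarith)]
      linarith
    have heq : 𝔲 t = w j t := h𝔲 j t ⟨ht1, by linarith⟩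
    simp only [mem_setOf_eq, uncurry_apply_pair, not_le] at hzO ⊢
    rw [heq, ← ofReal_norm, ← ENNReal.ofReal_toReal hBtop]
    exact (ENNReal.ofReal_lt_ofReal_iff (lt_trans (by positivity) hzO)).2 (by linarith)
  have hApos : volume A ≠ 0 := by
    rw [hA, Measure.volume_eq_prod, Measure.prod_prod, Real.volume_Ico, add_sub_cancel_left]
    exact mul_ne_zero (by simpa using hε₁pos) (Metric.measure_ball_pos volume y₀ hε₁pos).ne'
  exact hApos (measure_mono_null (subset_inter hAbig hAQ) hnull)

end IsNSICantorBlock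

/-! ### The two named facts and the assembled barrier -/

/-- **Fact A′ — the Cantor switching principle** (Ożański 2017, §6.2, (6.18) and p. 30:
"we obtain a solution to Theorem 14. Indeed, that `𝔲` is a weak solution to the NSI follows as
in the case of Theorem 1"; Scheffer 1987, (5.39) with Lemmas 5.9–5.13). For every Cantor block
(`IsNSICantorBlock T ν₀ τ M d G w`) there is a field `𝔲 : [0,∞) × ℝ³ → ℝ³` — in print the glued
field `𝔲(t) = w j(t)` on `[t_j, t_{j+1})`, `𝔲(t) = 0` for `t ≥ T₀ = T/(1-τ²)` ((6.18)) — which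
agrees with `w j` on `[t_j,t_{j+1})`, vanishes from `T₀` on, is a weak solution of the
Navier–Stokes inequality on `ℝ³ × (0,∞)` (tree rendering `IsWeakNSISolution`: `sup_t ‖𝔲(t)‖ < ∞`,
`∇𝔲 ∈ L²`, `div 𝔲 = 0`, the pressure function `p(t) = p̃[𝔲(t)]`, and the local energy
inequality, obtained from the per-piece inequalities (6.15) and the drops (6.16) at the
switching times) for EVERY `ν ∈ [0,ν₀]`, and has `C^∞` slices supported in `G` for all `t ≥ 0`.
The singularity of `{T₀} × S` is NOT part of this fact: it is proved from the agreement with the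
pieces (`IsNSICantorBlock.not_isRegularPoint`). Nothing asserted; to be discharged as
`nsiCantorSwitching_holds`.
[cite: Ozanski2017NSISingular, §6.2 (6.18) and p. 30] [cite: Scheffer1987, (5.39) and Lemmas 5.9–5.13] -/
def NSICantorSwitching : Prop :=
  ∀ (T ν₀ τ : ℝ) (M : ℕ) (d : Fin M → ℝ³) (G : Set ℝ³) (w : ℕ → ℝ → ℝ³ → ℝ³),
    IsNSICantorBlock T ν₀ τ M d G w →
    ∃ 𝔲 : ℝ → ℝ³ → ℝ³,
      (∀ j : ℕ, ∀ t ∈ Ico (switchTime T τ j) (switchTime T τ (j + 1)), 𝔲 t = w j t) ∧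
      (∀ t : ℝ, blowupTime T τ ≤ t → 𝔲 t = 0) ∧
      (∀ ν ∈ Icc (0 : ℝ) ν₀,
        IsWeakNSISolution ν 𝔲 fun t => Literature.Analysis.FluidPDE.normalisedPressure (𝔲 t)) ∧
      (∀ t : ℝ, 0 ≤ t → ContDiff ℝ ∞ (𝔲 t) ∧ tsupport (𝔲 t) ⊆ G)

/-- **Fact B′ — existence of a Cantor block for every `ξ ∈ (0,1)`** (Ożański 2017, §6.2: the
geometric arrangement with (6.2) `τ^ξ M ≥ 1`, `τM < 1`, (6.3), (6.6)–(6.7), constructed in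
§6.5; `ν₀` from (4.13); Prop. 16 (proved in §6.3–§6.4: the fields `v^{(j)}`, the new
oscillatory processes Thm. 17); and the rescaling (6.13) with the derived properties
(6.14)–(6.17) and the bounds of p. 30. Scheffer 1987: §4 (geometric building blocks),
Lemma 3.2 (oscillatory process), Lemmas 5.5–5.8). For every `ξ ∈ (0,1)` there are
`T, ν₀, τ, M`, `X > 0`, `z`, `G`, `w` forming an `IsNSICantorBlock` for the printed similarities
`Γ_n(x) = τx + z + (n-1)(X,0,0)` (translations along the symmetry axis `Ox₁`, `z = (z₁,z₂,0)` in
the plane `{x₃ = 0}`), with `τ^ξ M ≥ 1` and `τM < 1`. Written in the TREE's axisymmetric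
coordinates — axis `x 2` (`eZ = EuclideanSpace.single 2 1`), meridian plane `{x 1 = 0}`
(`meridianPoint (r,z) = (r,0,z)`), the convention of the accepted
`NavierStokesInequalityArrangement` under which Ożański's `x₁` is our `x 2` and his `x₃` is our
`x 1` — the data read `d n = z + nX • EuclideanSpace.single 2 1`, `n = 0,…,M-1`, and `z 1 = 0`.
The heart of Scheffer's construction; nothing asserted.
[cite: Ozanski2017NSISingular, §6.2 (6.2)–(6.3), Prop. 16, (6.13)–(6.17), §6.5]
[cite: Scheffer1987, Lemmas 3.2, 5.5–5.8 and §4] -/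
def NSICantorBlockExists : Prop :=
  ∀ ξ : ℝ, 0 < ξ → ξ < 1 →
    ∃ (T ν₀ τ : ℝ) (M : ℕ) (X : ℝ) (z : ℝ³) (G : Set ℝ³) (w : ℕ → ℝ → ℝ³ → ℝ³),
      1 ≤ τ ^ ξ * M ∧ τ * M < 1 ∧ 0 < X ∧ z 1 = 0 ∧
      IsNSICantorBlock T ν₀ τ M (fun n => z + (((n : ℕ) : ℝ) * X) • EuclideanSpace.single 2 1) G w

/-- The time-`T₀` slice map `x ↦ (T₀, x)` is an isometry into space–time `ℝ × ℝ³` (sup metric),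
so it preserves Hausdorff dimension. [folklore] -/
theorem isometry_mk_time (T₀ : ℝ) : Isometry fun x : ℝ³ => ((T₀, x) : ℝ × ℝ³) :=
  fun x y => by simp [Prod.edist_eq]

/-- **Assembly (proved): Scheffer's 1987 theorem from the Cantor switching principle and the
Cantor block.** Facts A′ and B′ imply the barrier fact
`NavierStokesInequalityNearlyOneDimSingularSet` (Scheffer 1987, Theorem of §1, in the form of
Ożański 2020, Thm. 1.6): given `ξ ∈ (0,1)`, take the block of B′, the glued field `𝔲` of A′,
`K = G`, `p = p̃[𝔲(·)]`, viscosity `ν₀`; the slice `{T₀} × S` of the Cantor set lies in the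
singular set `singularSet 𝔲 ((0,∞) × ℝ³)` (`T₀ > 0`, `IsNSICantorBlock.not_isRegularPoint`) and
is isometric to `S`, whence
`dim_H(singular set) ≥ dim_H S ≥ ξ` (`IsNSICantorBlock.ofReal_le_dimH_limitSet`). This is the
last paragraph of Ożański 2017, §6.2 (p. 30) and of Scheffer 1987, p. 551.
[cite: Ozanski2017NSISingular, §6.2 p. 30] [cite: Scheffer1987, p. 551] -/
theorem navierStokesInequalityNearlyOneDimSingularSet_of_cantorSwitching
    (hA : NSICantorSwitching) (hB : NSICantorBlockExists) :
    NavierStokesInequalityNearlyOneDimSingularSet := by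
  intro ξ hξ₀ hξ₁
  obtain ⟨T, ν₀, τ, M, X, z, G, w, hξM, hτM, hX, -, hb⟩ := hB ξ hξ₀ hξ₁
  obtain ⟨𝔲, hagree, -, hsol, hslice⟩ := hA T ν₀ τ M _ G w hb
  refine ⟨ν₀, hb.ν₀_pos, G, 𝔲, fun t => Literature.Analysis.FluidPDE.normalisedPressure (𝔲 t),
    hb.isCompact, hsol ν₀ ⟨hb.ν₀_pos.le, le_rfl⟩, hslice, ?_⟩
  set S := CantorDust.limitSet τ (fun n : Fin M => z + (((n : ℕ) : ℝ) * X) • EuclideanSpace.single 2 1) G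
    with hS
  have hsub : (fun x : ℝ³ => ((blowupTime T τ, x) : ℝ × ℝ³)) '' S ⊆
      Literature.Analysis.FluidPDE.singularSet 𝔲 ((positiveTimes : Opens (ℝ × ℝ³)) : Set (ℝ × ℝ³)) := by
    rintro _ ⟨x, hx, rfl⟩
    rw [Literature.Analysis.FluidPDE.mem_singularSet, coe_positiveTimes]
    exact ⟨⟨hb.blowupTime_pos, mem_univ _⟩, hb.not_isRegularPoint hagree hx⟩
  calc ENNReal.ofReal ξ ≤ dimH S := hb.ofReal_le_dimH_limitSet hX hτM hξ₀.le hξM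
    _ = dimH ((fun x : ℝ³ => ((blowupTime T τ, x) : ℝ × ℝ³)) '' S) :=
        ((isometry_mk_time (blowupTime T τ)).dimH_image S).symm
    _ ≤ _ := dimH_mono hsub

end Literature.Barriers.NavierStokesRegularity
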